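import Literature.MathematicalPhysics.QuantumFieldTheory.Balaban1983to89.T4AveragingDeficitWall
import Literature.MathematicalPhysics.QuantumFieldTheory.Balaban1983to89.B7Prop1Local
import Summits.QuantumFields.BalabanUV.T4Continuum.Support.AveragingDeficitNearIdentity
import HarnessLib

/-!
# T⁴ programme, node NE3 — census R39 (brick (i), file 1): THE COVARIANT `μ`-DIFFERENCE OF A LADDER HOLONOMY is a sum of covariant PLAQUETTE GRADIENTS plus second-order
# transport terms: `‖Ad_{V(p−e_μ,μ)}V(p; ladder_Q μ) − V(p−e_μ; ladder_Q μ)‖ ≤ |Q|·x₁ + 2|Q|²·x²`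

Cell `pub-balaban-gaps` (YM blitz, track G2, seat `ne3`, unit `pub-balaban-gaps-ne3-g8`; writer prover-pub-balaban-gaps-ne3-g8-0, 2026-08-24), census
`run/shared/lean/pub/pub-balaban-gaps/ne/NE3.md` §4 R39, §14.  WHY.  `Spine/NE3/LandauCorrectionSupB8LocalGauge.supRegularity_of_axialDivergence` reduced the curved (H0_W) to ONE
fact about the background: the lattice divergence of `E := W^{axial} − 1` is `≤ δ` on cubes of radius `R`, with `R·δ·M` small.  In the axial gauge of [Balaban1985Averaging]
pp. 24–25 a `μ`-bond variable is a conjugated LADDER holonomy (`B8Lemma1NonAbelian.axial_bond_eq_sharp`): `V₀(x, x+e_μ) = V₀(w; ladder_Q μ)`, `Q` = tree word of the low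
part of `x − base`, and the two consecutive `μ`-bonds `(x − e_μ, μ)`, `(x, μ)` share `Q` with base points `w − e_μ`, `w`.  So `E(x,μ) − E(x−e_μ,μ)` is the COVARIANT
`μ`-DIFFERENCE of the loop functional `p ↦ V(p; ladder_Q μ)`.  THIS FILE bounds that difference for ANY unitary configuration `V` with plaquettes within `x` of `1`
(`SmallField V x`) and covariant plaquette `μ`-gradients within `x₁` (`‖Ad_{V(p,μ)}V(∂p(p+e_μ; κ,μ)) − V(∂p(p; κ,μ))‖ ≤ x₁`, the (1.34)∕[B11] Thm 1 (10)-TYPE datum):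

**`ladder_covDiff_le`**: for every FORWARD word `Q` avoiding the direction `μ` and every base point `p`,
`‖V(p; ladder_Q μ) − 1‖ ≤ |Q|·x` and `‖Ad_{V(p−e_μ,μ)} V(p; ladder_Q μ) − V(p−e_μ; ladder_Q μ)‖ ≤ |Q|·x₁ + 2|Q|²·x²`.
INDUCTION (`hol_ladder_cons`): `Λ_{l::Q′}(p) = S·Λ_{Q′}(p+e_κ)·S⁻¹·P(p)` with `S = V(p,κ)`, `P(p) = V(∂p(p; κ, μ))`; the two transports `U·S` and `S̃·U′` around the plaquette
`(μ, κ)` at `p − e_μ` differ by its holonomy `Pl` (`‖Pl − 1‖ ≤ x`), so `Ad_U Λ(p) − Λ(p−e_μ) = [Ad_Pl Y − Y]·Ad_U P + Ad_{PlS̃}D′·Ad_U P + Y·(Ad_U P(p) − P(p−e_μ))` with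
`Y = Ad_{S̃}Λ_{Q′}(p+e_κ−e_μ)` (`‖Y − 1‖ ≤ |Q′|x`), `D′` the previous difference: `≤ 2x·|Q′|x + ‖D′‖ + x₁`.

File 2 (`Spine/NE3/AxialGaugeDivergence`) reads it in the axial gauge (tree holonomies `= 1`) and sums over `μ`: `‖div E‖ ≤ d(2d(R+1)x₁ + 8d²(R+1)²x²)` on the cube.

CONTENT (0 sorry; no `def`; [folklore] lattice gauge kinematics).  HONEST FRAMING.  Kinematics of an arbitrary unitary lattice configuration; nothing about Bałaban's
minimisers; (H0_W)∕`hK` at curved `W`, the covariant root and **NE3 are NOT proved** here; spine PROVED 0∕9; finite T⁴ rung (B)+1 — NOT infinite volume, NOT mass gap,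
NOT `BetaPertH`, NOT Clay.  PLACEMENT: `Summits/QuantumFields/BalabanUV/T4Continuum/Support/`.
-/

set_option autoImplicit false

open scoped BigOperators Matrix Matrix.Norms.L2Operator
open NormedSpace Finset

namespace Summit.QuantumFields.BalabanUV.T4Continuum.NE3LadderCovariantDifference

open Literature.MathematicalPhysics.QuantumFieldTheory.Balaban1983to89
open B7Prop1Explicit B7Prop2Explicit
open B7Prop1Local (hol_plaqWord_eq)
open T4AveragingDeficitWall (Ad IsUnitaryCfg SmallField)
open T4AveragingDeficitNonAbelian (Ad_mul Ad_sub)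
open AveragingDeficitNearIdentity (norm_Ad_sub_le Ad_one)
open AveragingDeficitTransport (norm_Ad_of_unitary mem_U1_of_unitary)

noncomputable section

variable {d : ℕ} {n : Type*} [Fintype n] [DecidableEq n]

/-! ## §1 Small unitary algebra -/

/-- `‖u‖ = 1` as a matrix for `u ∈ unitaryUnits`. [folklore] -/
theorem norm_coe_eq_one [Nonempty n] {u : (Matrix n n ℂ)ˣ} (hu : u ∈ unitaryUnits (Matrix n n ℂ)) : ‖(u : Matrix n n ℂ)‖ = 1 :=
  CStarRing.norm_of_mem_unitary (mem_unitaryUnits.mp hu)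

/-- `‖Ad_Pl Y − Y‖ ≤ 2‖Pl − 1‖·‖Y − 1‖` (conjugation fixes `1`). [folklore] -/
theorem norm_Ad_sub_le_of_sub_one [Nonempty n] {Q : (Matrix n n ℂ)ˣ} (hQ : Q ∈ unitaryUnits (Matrix n n ℂ)) (Y : Matrix n n ℂ) :
    ‖Ad Q Y - Y‖ ≤ 2 * ‖(Q : Matrix n n ℂ) - 1‖ * ‖Y - 1‖ := by
  have h1 : Ad Q (1 : Matrix n n ℂ) = 1 := by unfold Ad; rw [mul_one, Units.mul_inv]
  have h : Ad Q Y - Y = Ad Q (Y - 1) - (Y - 1) := by rw [Ad_sub, h1]; abel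
  rw [h]; exact norm_Ad_sub_le hQ _

/-! ## §2 The covariant `μ`-difference of a ladder holonomy -/

/-- **THE LADDER HOLONOMY IS NEAR `1` AND ITS COVARIANT `μ`-DIFFERENCE IS A SUM OF PLAQUETTE GRADIENTS** (any unitary `V` with `SmallField V x` and covariant plaquette
`μ`-gradients `≤ x₁`; `Q` a forward word avoiding `μ`): `‖V(p; ladder_Q μ) − 1‖ ≤ |Q|·x` and
`‖Ad_{V(p−e_μ,μ)}V(p; ladder_Q μ) − V(p−e_μ; ladder_Q μ)‖ ≤ |Q|·x₁ + 2|Q|²·x²`. [folklore] -/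
theorem ladder_covDiff_le [Nonempty n] {V : Site d → Fin d → (Matrix n n ℂ)ˣ} (hV : IsUnitaryCfg V) (μ : Fin d) {x x₁ : ℝ} (hx0 : 0 ≤ x)
    (hplaq : SmallField V x)
    (hgrad : ∀ (p : Site d) (κ : Fin d), κ ≠ μ →
      ‖Ad (V p μ) ((hol V (p + e μ) (plaqWord κ μ) : (Matrix n n ℂ)ˣ) : Matrix n n ℂ) - ((hol V p (plaqWord κ μ) : (Matrix n n ℂ)ˣ) : Matrix n n ℂ)‖ ≤ x₁) :
    ∀ (Q : List (Letter d)), (∀ l ∈ Q, l.2 = true ∧ l.1 ≠ μ) → ∀ p : Site d,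
      ‖((hol V p (ladder Q μ) : (Matrix n n ℂ)ˣ) : Matrix n n ℂ) - 1‖ ≤ Q.length * x ∧
      ‖Ad (V (p - e μ) μ) ((hol V p (ladder Q μ) : (Matrix n n ℂ)ˣ) : Matrix n n ℂ) - ((hol V (p - e μ) (ladder Q μ) : (Matrix n n ℂ)ˣ) : Matrix n n ℂ)‖
        ≤ Q.length * x₁ + 2 * (Q.length : ℝ) ^ 2 * x ^ 2
  | [], _, p => by
      have h1 : ((hol V p (ladder [] μ) : (Matrix n n ℂ)ˣ) : Matrix n n ℂ) = 1 := by simp [ladder, revWord, stepHol_true, stepHol_false]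
      have h2 : ((hol V (p - e μ) (ladder [] μ) : (Matrix n n ℂ)ˣ) : Matrix n n ℂ) = 1 := by simp [ladder, revWord, stepHol_true, stepHol_false]
      rw [h1, h2]
      constructor
      · simp
      · unfold Ad; rw [mul_one, Units.mul_inv]; simp
  | l :: Q, hQ, p => by
      obtain ⟨κ, b⟩ := l
      obtain ⟨hb, hκμ⟩ := hQ (κ, b) (by simp)
      simp only at hb hκμ
      subst hb
      have hQ' : ∀ l ∈ Q, l.2 = true ∧ l.1 ≠ μ := fun l hl => hQ l (List.mem_cons_of_mem _ hl)
      have hx10 : 0 ≤ x₁ := (norm_nonneg _).trans (hgrad p κ hκμ)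
      -- names
      set S : (Matrix n n ℂ)ˣ := V p κ with hS
      set St : (Matrix n n ℂ)ˣ := V (p - e μ) κ with hSt
      set U : (Matrix n n ℂ)ˣ := V (p - e μ) μ with hU
      set U' : (Matrix n n ℂ)ˣ := V (p + e κ - e μ) μ with hU'
      set P : (Matrix n n ℂ)ˣ := hol V p (plaqWord κ μ) with hP
      set Pt : (Matrix n n ℂ)ˣ := hol V (p - e μ) (plaqWord κ μ) with hPt
      set Λ1 : (Matrix n n ℂ)ˣ := hol V (p + e κ) (ladder Q μ) with hΛ1
      set Λ2 : (Matrix n n ℂ)ˣ := hol V (p + e κ - e μ) (ladder Q μ) with hΛ2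
      set Pl : (Matrix n n ℂ)ˣ := hol V (p - e μ) (plaqWord μ κ) with hPl
      have hSu : S ∈ unitaryUnits (Matrix n n ℂ) := hV _ _
      have hStu : St ∈ unitaryUnits (Matrix n n ℂ) := hV _ _
      have hUu : U ∈ unitaryUnits (Matrix n n ℂ) := hV _ _
      have hPu : P ∈ unitaryUnits (Matrix n n ℂ) := hol_mem_of (S := unitaryUnits (Matrix n n ℂ)) hV _ _
      have hPlu : Pl ∈ unitaryUnits (Matrix n n ℂ) := hol_mem_of (S := unitaryUnits (Matrix n n ℂ)) hV _ _
      have hΛ2u : Λ2 ∈ unitaryUnits (Matrix n n ℂ) := hol_mem_of (S := unitaryUnits (Matrix n n ℂ)) hV _ _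
      -- the induction hypothesis at the base point `p + e_κ`
      obtain ⟨ih1, ih2⟩ := ladder_covDiff_le hV μ hx0 hplaq hgrad Q hQ' (p + e κ)
      rw [← hΛ1] at ih1 ih2
      rw [show V (p + e κ - e μ) μ = U' from rfl, ← hΛ2] at ih2
      obtain ⟨ih1t, -⟩ := ladder_covDiff_le hV μ hx0 hplaq hgrad Q hQ' (p + e κ - e μ)
      rw [← hΛ2] at ih1t
      -- the recursion at `p` and at `p − e_μ`
      have hrec : hol V p (ladder ((κ, true) :: Q) μ) = S * Λ1 * S⁻¹ * P := by
        rw [hol_ladder_cons, stepHol_true, Letter.vec_true, lplaqWord_true]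
      have hrect : hol V (p - e μ) (ladder ((κ, true) :: Q) μ) = St * Λ2 * St⁻¹ * Pt := by
        rw [hol_ladder_cons, stepHol_true, Letter.vec_true, lplaqWord_true, show p - e μ + e κ = p + e κ - e μ by abel]
      -- the plaquette `(μ, κ)` at `p − e_μ`: `U·S = Pl·S̃·U′`
      have hPleq : Pl = U * S * U'⁻¹ * St⁻¹ := by
        rw [hPl, hol_plaqWord_eq, sub_add_cancel, show p - e μ + e κ = p + e κ - e μ by abel]
      have hUS : U * S = Pl * St * U' := by rw [hPleq]; group
      -- sizes
      have hxS : ‖(Pl : Matrix n n ℂ) - 1‖ ≤ x := hplaq (p - e μ) μ κ (Ne.symm hκμ)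
      have hxP : ‖(P : Matrix n n ℂ) - 1‖ ≤ x := hplaq p κ μ hκμ
      have hgr : ‖Ad U (P : Matrix n n ℂ) - (Pt : Matrix n n ℂ)‖ ≤ x₁ := by
        have h := hgrad (p - e μ) κ hκμ
        rwa [sub_add_cancel] at h
      have hlen : (((κ, true) :: Q).length : ℝ) = Q.length + 1 := by push_cast [List.length_cons]; ring
      constructor
      · -- `‖Λ − 1‖ ≤ (|Q|+1)·x`
        rw [hrec, Units.val_mul]
        have h1 : ‖((S * Λ1 * S⁻¹ : (Matrix n n ℂ)ˣ) : Matrix n n ℂ) - 1‖ ≤ ‖(Λ1 : Matrix n n ℂ) - 1‖ := by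
          rw [Units.val_mul, Units.val_mul]
          exact norm_units_conj_sub_one_le (mem_U1_of_unitary hSu) _
        have hAB : ∀ (A B : Matrix n n ℂ), ‖B‖ ≤ 1 → ‖A * B - 1‖ ≤ ‖A - 1‖ + ‖B - 1‖ := by
          intro A B hB
          have h : A * B - 1 = (A - 1) * B + (B - 1) := by noncomm_ring
          rw [h]
          calc ‖(A - 1) * B + (B - 1)‖ ≤ ‖(A - 1) * B‖ + ‖B - 1‖ := norm_add_le _ _
            _ ≤ ‖A - 1‖ * ‖B‖ + ‖B - 1‖ := by gcongr; exact norm_mul_le _ _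
            _ ≤ ‖A - 1‖ * 1 + ‖B - 1‖ := by gcongr
            _ = ‖A - 1‖ + ‖B - 1‖ := by ring
        calc ‖((S * Λ1 * S⁻¹ : (Matrix n n ℂ)ˣ) : Matrix n n ℂ) * (P : Matrix n n ℂ) - 1‖ ≤ ‖((S * Λ1 * S⁻¹ : (Matrix n n ℂ)ˣ) : Matrix n n ℂ) - 1‖ + ‖(P : Matrix n n ℂ) - 1‖ :=
              hAB _ _ (norm_coe_eq_one hPu).le
          _ ≤ Q.length * x + x := add_le_add (h1.trans ih1) hxP
          _ = ((κ, true) :: Q).length * x := by rw [hlen]; ring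
      · -- the covariant difference
        have hkey : Ad U ((hol V p (ladder ((κ, true) :: Q) μ) : (Matrix n n ℂ)ˣ) : Matrix n n ℂ) - ((hol V (p - e μ) (ladder ((κ, true) :: Q) μ) : (Matrix n n ℂ)ˣ) : Matrix n n ℂ)
            = (Ad Pl (Ad St (Λ2 : Matrix n n ℂ)) - Ad St (Λ2 : Matrix n n ℂ)) * Ad U (P : Matrix n n ℂ)
              + Ad (Pl * St) (Ad U' (Λ1 : Matrix n n ℂ) - (Λ2 : Matrix n n ℂ)) * Ad U (P : Matrix n n ℂ)
              + Ad St (Λ2 : Matrix n n ℂ) * (Ad U (P : Matrix n n ℂ) - (Pt : Matrix n n ℂ)) := by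
          rw [hrec, hrect]
          -- `Ad U (S Λ1 S⁻¹ P) = Ad (U S) Λ1 · Ad U P` and `U S = Pl St U'`
          have hAdU : ∀ (A Y : (Matrix n n ℂ)ˣ), Ad A (Y : Matrix n n ℂ) = ((A * Y * A⁻¹ : (Matrix n n ℂ)ˣ) : Matrix n n ℂ) := fun A Y => by
            unfold Ad; simp only [Units.val_mul]
          have e1 : Ad U (((S * Λ1 * S⁻¹ * P : (Matrix n n ℂ)ˣ) : Matrix n n ℂ)) = Ad (Pl * St) (Ad U' (Λ1 : Matrix n n ℂ)) * Ad U (P : Matrix n n ℂ) := by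
            rw [hAdU, hAdU, hAdU, hAdU, ← Units.val_mul]
            congr 1
            rw [hPleq]
            group
          have e2 : (((St * Λ2 * St⁻¹ * Pt : (Matrix n n ℂ)ˣ) : Matrix n n ℂ)) = Ad St (Λ2 : Matrix n n ℂ) * (Pt : Matrix n n ℂ) := by
            unfold Ad; simp only [Units.val_mul]
          rw [e1, e2]
          simp only [Ad_mul, Ad_sub]
          noncomm_ring
        rw [hkey]
        have hY1 : ‖Ad St (Λ2 : Matrix n n ℂ) - 1‖ ≤ Q.length * x := by
          have : ‖Ad St (Λ2 : Matrix n n ℂ) - 1‖ ≤ ‖(Λ2 : Matrix n n ℂ) - 1‖ := by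
            unfold Ad; exact norm_units_conj_sub_one_le (mem_U1_of_unitary hStu) _
          exact this.trans ih1t
        have hY : ‖Ad St (Λ2 : Matrix n n ℂ)‖ = 1 := by rw [norm_Ad_of_unitary hStu, norm_coe_eq_one hΛ2u]
        have hUP : ‖Ad U (P : Matrix n n ℂ)‖ = 1 := by rw [norm_Ad_of_unitary hUu, norm_coe_eq_one hPu]
        have hPlStu : Pl * St ∈ unitaryUnits (Matrix n n ℂ) := (unitaryUnits (Matrix n n ℂ)).mul_mem hPlu hStu
        have t1 : ‖(Ad Pl (Ad St (Λ2 : Matrix n n ℂ)) - Ad St (Λ2 : Matrix n n ℂ)) * Ad U (P : Matrix n n ℂ)‖ ≤ 2 * x * (Q.length * x) := by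
          calc _ ≤ ‖Ad Pl (Ad St (Λ2 : Matrix n n ℂ)) - Ad St (Λ2 : Matrix n n ℂ)‖ * ‖Ad U (P : Matrix n n ℂ)‖ := norm_mul_le _ _
            _ ≤ (2 * ‖(Pl : Matrix n n ℂ) - 1‖ * ‖Ad St (Λ2 : Matrix n n ℂ) - 1‖) * 1 := by
                rw [hUP]; exact mul_le_mul_of_nonneg_right (norm_Ad_sub_le_of_sub_one hPlu _) zero_le_one
            _ ≤ 2 * x * (Q.length * x) := by
                rw [mul_one]; gcongr
        have t2 : ‖Ad (Pl * St) (Ad U' (Λ1 : Matrix n n ℂ) - (Λ2 : Matrix n n ℂ)) * Ad U (P : Matrix n n ℂ)‖ ≤ Q.length * x₁ + 2 * (Q.length : ℝ) ^ 2 * x ^ 2 := by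
          calc _ ≤ ‖Ad (Pl * St) (Ad U' (Λ1 : Matrix n n ℂ) - (Λ2 : Matrix n n ℂ))‖ * ‖Ad U (P : Matrix n n ℂ)‖ := norm_mul_le _ _
            _ = ‖Ad U' (Λ1 : Matrix n n ℂ) - (Λ2 : Matrix n n ℂ)‖ := by rw [hUP, mul_one, norm_Ad_of_unitary hPlStu]
            _ ≤ _ := ih2
        have t3 : ‖Ad St (Λ2 : Matrix n n ℂ) * (Ad U (P : Matrix n n ℂ) - (Pt : Matrix n n ℂ))‖ ≤ x₁ := by
          calc _ ≤ ‖Ad St (Λ2 : Matrix n n ℂ)‖ * ‖Ad U (P : Matrix n n ℂ) - (Pt : Matrix n n ℂ)‖ := norm_mul_le _ _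
            _ ≤ 1 * x₁ := by rw [hY]; exact mul_le_mul_of_nonneg_left hgr zero_le_one
            _ = x₁ := one_mul _
        calc _ ≤ ‖(Ad Pl (Ad St (Λ2 : Matrix n n ℂ)) - Ad St (Λ2 : Matrix n n ℂ)) * Ad U (P : Matrix n n ℂ) + Ad (Pl * St) (Ad U' (Λ1 : Matrix n n ℂ) - (Λ2 : Matrix n n ℂ)) * Ad U (P : Matrix n n ℂ)‖
              + ‖Ad St (Λ2 : Matrix n n ℂ) * (Ad U (P : Matrix n n ℂ) - (Pt : Matrix n n ℂ))‖ := norm_add_le _ _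
          _ ≤ (2 * x * (Q.length * x) + (Q.length * x₁ + 2 * (Q.length : ℝ) ^ 2 * x ^ 2)) + x₁ :=
              add_le_add ((norm_add_le _ _).trans (add_le_add t1 t2)) t3
          _ ≤ ((κ, true) :: Q).length * x₁ + 2 * (((κ, true) :: Q).length : ℝ) ^ 2 * x ^ 2 := by
              rw [hlen]
              nlinarith [mul_nonneg (Nat.cast_nonneg Q.length) (sq_nonneg x), sq_nonneg x, hx10]

end

end Summit.QuantumFields.BalabanUV.T4Continuum.NE3LadderCovariantDifference
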